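import Mathlib
import HarnessLib
import Literature.MathematicalPhysics.StatisticalMechanics.StepMeasureComparisonTrace

/-!
# The dimension-free comparison of two multiplier Gaussians WITHOUT smallness: telescoping along the
# segment of multipliers ([Buc16] Thm 4.5, integrated form; [ABKM19] Lemma 8.4 (`ℓ = 1`) preparation)

`StepMeasureComparisonTrace.norm_integral_mulMat_sub_le_of_sum_sq` needs the Hilbert–Schmidt size `h` of the
change to be `≤ 1/(4q)`.  Along the segment `m_t = m₀ + t(m₁ − m₀)` of (even, positive) multipliers the
consecutive sizes of an `n`-piece subdivision are `≤ h_T/n` with `h_T² ≥ Σ_κ ρ(κ)²`, `ρ` a two-sided relative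
bound `|m₁ − m₀| ≤ ρ·m₀`, `|m₁ − m₀| ≤ ρ·m₁`; the chain form
`GaussianCovarianceComparisonTraceVector.norm_integral_multivariateGaussian_sub_le_of_trace_chain` then gives

* **`norm_integral_mulMat_sub_le_of_sum_sq_segment`** —
  `‖∫ H dN(0, mulMat m₁) − ∫ H dN(0, mulMat m₀)‖ ≤ 8 q h_T N_p` for every Banach-valued `H` with
  `H ∈ L^p(N(0, mulMat m_t))` and `(∫ ‖H‖^p dN(0, mulMat m_t))^{1/p} ≤ N_p` along the segment — no smallness of `h_T`.

Everything is proved; no named fact.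

## References
* S. Buchholz, J. Funct. Anal. 275 (2018), Thm 4.5 [Buchholz2016].
* S. Adams, S. Buchholz, R. Kotecký, S. Müller, arXiv:1910.13564, Remark 7.4, Lemma 8.4
  [AdamsBuchholzKoteckyMuller2019].
-/

noncomputable section

namespace Literature.MathematicalPhysics.StatisticalMechanics.GradientRG

open scoped BigOperators Matrix
open MeasureTheory ProbabilityTheory Finset WithLp
open Literature.MathematicalPhysics.StatisticalMechanics.GradientFRD (mulMat mulMat_mul mulMat_one
  mulMat_inv mulMat_sub trace_mulMat posDef_mulMat)
open Literature.MathematicalPhysics.QuantumFieldTheory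

variable {d M : ℕ} [NeZero M]

omit [NeZero M] in
/-- On `[0,1]` the segment stays above `min(m₀, m₁)`, hence positive, and `|m₁ − m₀| ≤ ρ · m_t` if
`|m₁ − m₀| ≤ ρ m₀` and `≤ ρ m₁`. [cite: Buchholz2016, Thm 4.5 (proof)] -/
theorem abs_sub_le_mul_mulSeg {m₀ m₁ ρ : (Fin d → ZMod M) → ℝ}
    (hρ0 : ∀ κ, |m₁ κ - m₀ κ| ≤ ρ κ * m₀ κ) (hρ1 : ∀ κ, |m₁ κ - m₀ κ| ≤ ρ κ * m₁ κ)
    {t : ℝ} (ht0 : 0 ≤ t) (ht1 : t ≤ 1) (κ : Fin d → ZMod M) :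
    |m₁ κ - m₀ κ| ≤ ρ κ * (m₀ κ + t * (m₁ κ - m₀ κ)) := by
  have : ρ κ * (m₀ κ + t * (m₁ κ - m₀ κ)) = (1 - t) * (ρ κ * m₀ κ) + t * (ρ κ * m₁ κ) := by
    ring
  rw [this]
  nlinarith [hρ0 κ, hρ1 κ]

omit [NeZero M] in
/-- Positivity of the segment on `[0,1]`. [cite: Buchholz2016, Thm 4.5 (proof)] -/
theorem mulSeg_pos {m₀ m₁ : (Fin d → ZMod M) → ℝ} (h0 : ∀ κ, 0 < m₀ κ) (h1 : ∀ κ, 0 < m₁ κ)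
    {t : ℝ} (ht0 : 0 ≤ t) (ht1 : t ≤ 1) (κ : Fin d → ZMod M) : 0 < (m₀ κ + t * (m₁ κ - m₀ κ)) := by
  have : (m₀ κ + t * (m₁ κ - m₀ κ)) = (1 - t) * m₀ κ + t * m₁ κ := by ring
  rw [this]
  rcases ht0.eq_or_lt with h | h
  · rw [← h]; simp [h0 κ]
  · nlinarith [h0 κ, h1 κ, mul_pos h (h1 κ)]

omit [NeZero M] in
/-- Evenness of the segment. [cite: Buchholz2016, Thm 4.5 (proof)] -/
theorem mulSeg_even {m₀ m₁ : (Fin d → ZMod M) → ℝ} (he0 : ∀ κ, m₀ (-κ) = m₀ κ) (he1 : ∀ κ, m₁ (-κ) = m₁ κ)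
    (t : ℝ) (κ : Fin d → ZMod M) : (m₀ (-κ) + t * (m₁ (-κ) - m₀ (-κ))) = (m₀ κ + t * (m₁ κ - m₀ κ)) := by
  simp only [he0, he1]

/-- Consecutive Hilbert–Schmidt sizes along the segment: for `0 ≤ s ≤ t ≤ 1`,
`Σ_κ (1 − m_s(κ)/m_t(κ))² ≤ (t − s)² Σ_κ ρ(κ)²`. [cite: Buchholz2016, Thm 4.5 (proof)] -/
theorem sum_sq_one_sub_mulSeg_div_le {m₀ m₁ ρ : (Fin d → ZMod M) → ℝ} (h0 : ∀ κ, 0 < m₀ κ) (h1 : ∀ κ, 0 < m₁ κ)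
    (hρ0 : ∀ κ, |m₁ κ - m₀ κ| ≤ ρ κ * m₀ κ) (hρ1 : ∀ κ, |m₁ κ - m₀ κ| ≤ ρ κ * m₁ κ)
    {s t : ℝ} (hs0 : 0 ≤ s) (hst : s ≤ t) (ht1 : t ≤ 1) :
    ∑ κ, (1 - (m₀ κ + s * (m₁ κ - m₀ κ)) / (m₀ κ + t * (m₁ κ - m₀ κ))) ^ 2 ≤ (t - s) ^ 2 * ∑ κ, ρ κ ^ 2 := by
  rw [Finset.mul_sum]
  refine sum_le_sum fun κ _ => ?_
  have hmt : 0 < (m₀ κ + t * (m₁ κ - m₀ κ)) := mulSeg_pos h0 h1 (hs0.trans hst) ht1 κ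
  have hkey : 1 - (m₀ κ + s * (m₁ κ - m₀ κ)) / (m₀ κ + t * (m₁ κ - m₀ κ)) = (t - s) * (m₁ κ - m₀ κ) / (m₀ κ + t * (m₁ κ - m₀ κ)) := by
    rw [eq_div_iff hmt.ne', sub_mul, div_mul_cancel₀ _ hmt.ne']
    ring
  rw [hkey, div_pow, mul_pow, div_le_iff₀ (by positivity)]
  have hρ := abs_sub_le_mul_mulSeg hρ0 hρ1 (hs0.trans hst) ht1 κ
  have hρnn : 0 ≤ ρ κ * (m₀ κ + t * (m₁ κ - m₀ κ)) := (abs_nonneg _).trans hρ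
  have h2 : (m₁ κ - m₀ κ) ^ 2 ≤ (ρ κ * (m₀ κ + t * (m₁ κ - m₀ κ))) ^ 2 := by
    rw [← sq_abs (m₁ κ - m₀ κ)]
    exact pow_le_pow_left₀ (abs_nonneg _) hρ 2
  nlinarith [sq_nonneg (t - s)]

/-- **Dimension-free comparison of two multiplier Gaussians without smallness** ([Buc16] Thm 4.5 in
integrated form along the segment of multipliers).  Let `m₀, m₁ > 0` be even multipliers with a two-sided
relative bound `|m₁ − m₀| ≤ ρ m₀`, `|m₁ − m₀| ≤ ρ m₁` and `Σ_κ ρ(κ)² ≤ h_T²` (`h_T ≥ 0`); `p, q` Hölder conjugate;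
`H` Banach-valued with `H ∈ L^p(N(0, mulMat m_t))` and `(∫ ‖H‖^p dN(0, mulMat m_t))^{1/p} ≤ N_p` for all
`t ∈ [0,1]` (`m_t = m₀ + t(m₁ − m₀)`).  Then
`‖∫ H dN(0, mulMat m₁) − ∫ H dN(0, mulMat m₀)‖ ≤ 8 q h_T N_p`. [cite: Buchholz2016, Thm 4.5] -/
theorem norm_integral_mulMat_sub_le_of_sum_sq_segment {m₀ m₁ ρ : (Fin d → ZMod M) → ℝ}
    (h0 : ∀ κ, 0 < m₀ κ) (h1 : ∀ κ, 0 < m₁ κ) (he0 : ∀ κ, m₀ (-κ) = m₀ κ) (he1 : ∀ κ, m₁ (-κ) = m₁ κ)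
    (hρ0 : ∀ κ, |m₁ κ - m₀ κ| ≤ ρ κ * m₀ κ) (hρ1 : ∀ κ, |m₁ κ - m₀ κ| ≤ ρ κ * m₁ κ)
    {hT : ℝ} (hhT : 0 ≤ hT) (hsum : ∑ κ, ρ κ ^ 2 ≤ hT ^ 2)
    {p q : ℝ} (hpq : p.HolderConjugate q)
    {F : Type*} [NormedAddCommGroup F] [NormedSpace ℝ F] [CompleteSpace F]
    {H : EuclideanSpace ℝ (Fin d → ZMod M) → F}
    (hH : ∀ t ∈ Set.Icc (0 : ℝ) 1, MemLp H (ENNReal.ofReal p) (multivariateGaussian 0 (mulMat (fun κ => m₀ κ + t * (m₁ κ - m₀ κ)))))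
    {Np : ℝ}
    (hNp : ∀ t ∈ Set.Icc (0 : ℝ) 1,
      (∫ y, ‖H y‖ ^ p ∂(multivariateGaussian 0 (mulMat (fun κ => m₀ κ + t * (m₁ κ - m₀ κ))))) ^ (1 / p) ≤ Np) :
    ‖∫ y, H y ∂(multivariateGaussian 0 (mulMat m₁)) - ∫ y, H y ∂(multivariateGaussian 0 (mulMat m₀))‖ ≤
      8 * q * hT * Np := by
  have hq1 : 1 < q := hpq.symm.lt
  have hq0 : 0 < q := by linarith
  -- number of pieces `n ≥ 4 q h_T`, `n ≥ 1`
  set n : ℕ := ⌈4 * q * hT⌉₊ + 1 with hndef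
  have hn1 : 1 ≤ n := by rw [hndef]; exact Nat.le_add_left 1 _
  have hnpos : (0 : ℝ) < n := by exact_mod_cast hn1
  have hnge : 4 * q * hT ≤ n := by
    rw [hndef]; push_cast
    exact (Nat.le_ceil _).trans (le_add_of_nonneg_right zero_le_one)
  -- the nodes `t_j = min(j/n, 1)`
  set tn : ℕ → ℝ := fun j => min ((j : ℝ) / n) 1 with htn
  have htn0 : ∀ j, 0 ≤ tn j := fun j => le_min (by positivity) zero_le_one
  have htn1 : ∀ j, tn j ≤ 1 := fun j => min_le_right _ _
  have htn_mono : ∀ j, tn j ≤ tn (j + 1) := fun j =>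
    min_le_min_right _ (div_le_div_of_nonneg_right (by push_cast; linarith) hnpos.le)
  have htn_step : ∀ j, tn (j + 1) - tn j ≤ 1 / n := by
    intro j
    have h1 : tn (j + 1) ≤ (j : ℝ) / n + 1 / n := by
      calc tn (j + 1) ≤ ((j + 1 : ℕ) : ℝ) / n := min_le_left _ _
        _ = (j : ℝ) / n + 1 / n := by push_cast; ring
    rcases le_or_gt ((j : ℝ) / n) 1 with hj | hj
    · have : tn j = (j : ℝ) / n := min_eq_left hj
      linarith
    · have h2 : tn j = 1 := min_eq_right hj.le
      have h3 : tn (j + 1) ≤ 1 := htn1 _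
      have : (0 : ℝ) ≤ 1 / n := by positivity
      linarith
  have htn_zero : tn 0 = 0 := by simp [htn]
  have htn_n : tn n = 1 := by
    simp only [htn]; rw [div_self hnpos.ne', min_self]
  -- the chain
  set S : ℕ → Matrix (Fin d → ZMod M) (Fin d → ZMod M) ℝ := fun j => mulMat (fun κ => m₀ κ + tn j * (m₁ κ - m₀ κ)) with hSdef
  have hmpos : ∀ j κ, 0 < (m₀ κ + (tn j) * (m₁ κ - m₀ κ)) := fun j κ => mulSeg_pos h0 h1 (htn0 j) (htn1 j) κ
  have hmev : ∀ j κ, (m₀ (-κ) + (tn j) * (m₁ (-κ) - m₀ (-κ))) = (m₀ κ + (tn j) * (m₁ κ - m₀ κ)) := fun j κ => mulSeg_even he0 he1 _ κ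
  have hS : ∀ j, (S j).PosDef := fun j => posDef_mulMat (hmpos j)
  have htr : ∀ j, ((S j * ((S j)⁻¹ - (S (j + 1))⁻¹)) * (S j * ((S j)⁻¹ - (S (j + 1))⁻¹))).trace ≤ (hT / n) ^ 2 := by
    intro j
    simp only [hSdef]
    rw [trace_mulMat_one_sub_inv_mul_sq (fun κ => (hmpos j κ).ne') (fun κ => (hmpos (j + 1) κ).ne')
      (hmev j) (hmev (j + 1))]
    calc ∑ κ, (1 - (m₀ κ + (tn j) * (m₁ κ - m₀ κ)) / (m₀ κ + (tn (j + 1)) * (m₁ κ - m₀ κ))) ^ 2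
        ≤ (tn (j + 1) - tn j) ^ 2 * ∑ κ, ρ κ ^ 2 :=
          sum_sq_one_sub_mulSeg_div_le h0 h1 hρ0 hρ1 (htn0 j) (htn_mono j) (htn1 _)
      _ ≤ (1 / n) ^ 2 * hT ^ 2 :=
          mul_le_mul (pow_le_pow_left₀ (by linarith [htn_mono j]) (htn_step j) 2) hsum
            (sum_nonneg fun κ _ => sq_nonneg _) (by positivity)
      _ = (hT / n) ^ 2 := by ring
  have hhq : hT / n ≤ 1 / (4 * q) := by
    rw [div_le_div_iff₀ hnpos (by positivity)]
    linarith
  have hmem : ∀ j, tn j ∈ Set.Icc (0 : ℝ) 1 := fun j => ⟨htn0 j, htn1 j⟩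
  have hchain := norm_integral_multivariateGaussian_sub_le_of_trace_chain S hS (fun _ => hT / n)
    (fun _ => by positivity) htr hpq (fun _ => hhq) (fun j => hH _ (hmem j)) (fun j => hNp _ (hmem j)) n
  have hsumconst : ∑ j ∈ Finset.range n, hT / (n : ℝ) = hT := by
    rw [sum_const, card_range, nsmul_eq_mul]; field_simp
  rw [hsumconst] at hchain
  have hS0 : S 0 = mulMat m₀ := by
    simp only [hSdef, htn_zero]; congr 1; funext κ; ring
  have hSn : S n = mulMat m₁ := by
    simp only [hSdef]; rw [htn_n]; congr 1; funext κ; ring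
  rw [hS0, hSn] at hchain
  exact hchain

end Literature.MathematicalPhysics.StatisticalMechanics.GradientRG

end
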